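import Literature.NumberTheory.LFunctions.StarkNoQuadraticSubfieldProofs
import HarnessLib

/-!
# Stark 1974, Theorem 3 for an ARBITRARY number field: a real zero of `ζ_K` very near `1`
# is a zero of `ζ_k` for a quadratic subfield `k ⊆ K`

Topic `Literature/NumberTheory/LFunctions`, namespace
`Literature.NumberTheory.LFunctions.NumberField`. Everything in this file is PROVED (theorems only:
no definition, no named fact, no `sorry`).

> **Stark, Invent. Math. 23 (1974), Theorem 3 with Lemma 3**, in the form printed by V. Kumar Murty,
> *Stark zeros in certain towers of fields*, Math. Res. Lett. 6 (1999) 511–519, p. 512, (4):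
> "Let `n = [K : ℚ]` … If `s₀ = β_K` satisfies the stronger condition
> `β ≥ 1 − 1/(4 n! log d_K)`, then Stark showed that there is an extension `F` with
> `ℚ ⊆ F ⊆ K`, `[F : ℚ] ≤ 2` and such that `ζ_F(β) = 0`."

(`[F : ℚ] = 2` necessarily: `ζ_ℚ(β) = ζ(β) < 0` for `0 < β < 1`.) The tree already holds the two
halves of this statement: the abstract Heilbronn–Stark theorem
(`Heilbronn.exists_index_two_of_dedekindZetaCont_eq_zero`, `HeilbronnStark.lean`), its corollary for
fields WITHOUT quadratic subfield (`Stark1974_dedekindZeta_ne_zero_of_noQuadraticSubfield_holds`,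
`StarkNoQuadraticSubfieldProofs.lean`, via the normal closure) and the locating form for GALOIS fields
(`exists_quadratic_dedekindZetaCont_eq_zero_of_isGalois`, `StarkGaloisQuadraticSubfield.lean`).
This file records the locating form for an ARBITRARY number field `K ≠ ℚ` of degree `n`:

* `exists_quadratic_dedekindZetaCont_eq_zero` — if `1 − 1/(4·n!·log|d_K|) ≤ σ < 1` and
  `ζ_K(σ) = 0`, then `ζ_k(σ) = 0` for some subfield `k ⊆ K` with `[k : ℚ] = 2`;
* `dedekindZetaCont_ne_zero_of_forall_quadratic` — contrapositive: if no quadratic subfield `k`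
  of `K` has `ζ_k(σ) = 0`, then `ζ_K(σ) ≠ 0` (this CONTAINS the no-quadratic-subfield corollary).

Proof (the glue of `StarkNoQuadraticSubfieldGlue.lean`, exactly as in
`StarkNoQuadraticSubfieldProofs.lean`): `N₀ ⊆ ℚ̄` the normal closure of `K/ℚ`,
`q : Γ_ℚ → G = Gal(N₀/ℚ)`, `[N₀:ℚ] ≤ n!`, `|d_{N₀}| ≤ |d_K|^{[N₀:ℚ]}`, so `σ` lies in Stark's box for
`N₀` and `ord_σ ζ_{N₀} ≤ 1` (Stark's Lemma 3); `ζ(σ) < 0`; if `ζ_K(σ) = 0` then Heilbronn's character is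
a character `χ₁ ≠ 1` of order `2` with `ζ_{F_{H'}}(σ) = 0 ↔ H' ≤ ker χ₁`
(`dedekindZetaCont_quotientFixedField_eq_zero_iff`); the fixed field of `ker χ₁` is a quadratic field
inside the embedded copy `f(K)` of `K` at which `ζ` vanishes; transport it back along `f`.

Used by `ClassGroupLFunctionExceptionalZeroQuadraticField.lean` (an exceptional zero of a real class
group `L`-function of ANY number field is a zero of a quadratic Dirichlet `L`-function).

## References

* H. M. Stark, *Some effective cases of the Brauer–Siegel theorem*, Invent. Math. 23 (1974)
  135–152, Lemma 3, Theorem 3. [Stark1974]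
* V. Kumar Murty, *Stark zeros in certain towers of fields*, Math. Res. Lett. 6 (1999) 511–519,
  p. 512, display (4). [Murty1999StarkZeros]
* M. R. Murty, V. K. Murty, *Non-vanishing of `L`-functions and applications*, Birkhäuser 1997,
  Ch. 2 §6, Prop. 6.1, Cor. 6.2. [MurtyMurty1997]
-/

noncomputable section

open scoped NumberField ComplexConjugate ComplexOrder
open Complex NumberField IntermediateField
open Literature.NumberTheory.Automorphic Literature.NumberTheory.LFunctions.Heilbronn

attribute [local instance 1001] AlgebraicClosure.instAlgebra IntermediateField.algebra'
  IntermediateField.module'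

namespace Literature.NumberTheory.LFunctions.NumberField

/-- **Stark 1974, Theorem 3 (with Lemma 3), for an arbitrary number field.** Let `K` be a number
field of degree `n > 1` and `σ` real with `1 − 1/(4·n!·log|d_K|) ≤ σ < 1`. If `ζ_K(σ) = 0` then
`ζ_k(σ) = 0` for some quadratic subfield `k ⊆ K`.
[cite: Stark1974, Thm. 3 and Lemma 3] [cite: Murty1999StarkZeros, p. 512 (4)]
[cite: MurtyMurty1997, Ch. 2 Cor. 6.2] -/
theorem exists_quadratic_dedekindZetaCont_eq_zero (K : Type) [Field K] [NumberField K]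
    (hK : 1 < Module.finrank ℚ K) {σ : ℝ}
    (hσ : 1 - 1 / (4 * ((Module.finrank ℚ K).factorial : ℝ) * Real.log ((discr K).natAbs : ℝ)) ≤ σ)
    (hσ1 : σ < 1) (h0 : dedekindZetaCont K σ = 0) :
    ∃ k : IntermediateField ℚ K, Module.finrank ℚ k = 2 ∧ dedekindZetaCont k σ = 0 := by
  classical
  -- degree `n ≥ 2`: `|d_K| ≥ 3`, `0 < σ < 1`
  have hdK : 3 ≤ (discr K).natAbs := three_le_natAbs_discr K hK
  have hk : 2 ≤ (Module.finrank ℚ K).factorial := by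
    have h := Nat.factorial_le (Nat.succ_le_of_lt hK)
    rwa [Nat.factorial_two] at h
  have hσ0 : 0 < σ := pos_of_one_sub_inv_log_le hdK hk hσ
  have hs1 : (σ : ℂ) ≠ 1 := fun h => hσ1.ne (by exact_mod_cast h)
  have hreal : conj (σ : ℂ) = σ := Complex.conj_ofReal σ
  -- the normal closure `N₀` of `K` inside `ℚ̄`, an embedded copy `E = f(K)`, `q : Γ_ℚ → Gal(N₀/ℚ)`
  let L := AlgebraicClosure ℚ
  let N₀ : IntermediateField ℚ L := normalClosure ℚ K L
  let f : K →ₐ[ℚ] L := IsAlgClosed.lift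
  have hE : f.fieldRange ≤ N₀ := f.fieldRange_le_normalClosure
  obtain ⟨q, hq⟩ : ∃ q : Field.absoluteGaloisGroup ℚ →* (N₀ ≃ₐ[ℚ] N₀),
      q = AlgEquiv.restrictNormalHom N₀ := ⟨_, rfl⟩
  have hqA : IsArtinQuotient q := isArtinQuotient_of_eq_restrictNormalHom hq
  haveI hNF : ∀ H', NumberField (quotientFixedField q H') :=
    fun H' => numberField_quotientFixedField hqA H'
  set H : Subgroup (N₀ ≃ₐ[ℚ] N₀) := (f.fieldRange.fixingSubgroup).map q
  have hHE : quotientFixedField q H = f.fieldRange := quotientFixedField_map_fixingSubgroup hq hE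
  have hbot : quotientFixedField q ⊥ = N₀ := quotientFixedField_bot_of_eq_restrictNormalHom hq
  have htop' : quotientFixedField q ⊤ = ⊥ := quotientFixedField_top_eq_bot (q := q)
  -- `N₀/ℚ` is a Galois number field of degree `#Gal(N₀/ℚ) ≤ n!` containing a copy of `K`
  haveI : IsGalois ℚ N₀ :=
    { to_isSeparable := Algebra.isSeparable_tower_bot_of_isSeparable ℚ N₀ L }
  haveI : NumberField N₀ := NumberField.of_module_finite ℚ N₀
  have eK : K ≃ₐ[ℚ] f.fieldRange := f.equivFieldRange
  have hKN : Module.finrank ℚ K ≤ Module.finrank ℚ N₀ := by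
    rw [eK.toLinearEquiv.finrank_eq]
    exact IntermediateField.finrank_le_of_le_right hE
  have hN1 : 1 < @Module.finrank ℚ N₀ _ _ DivisionRing.toRatAlgebra.toModule :=
    lt_of_lt_of_le hK (hKN.trans_eq (finrank_rat_eq_finrank_rat _ _))
  have hm : Module.finrank ℚ N₀ ≤ (Module.finrank ℚ K).factorial := by
    rw [← IsGalois.card_aut_eq_finrank ℚ N₀, Nat.card_eq_fintype_card]
    exact card_algEquiv_normalClosure_le_factorial ℚ K L
  -- `|d_{N₀}| ≤ |d_K|^{[N₀:ℚ]}`, so `σ` lies in Stark's box for `N₀`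
  have hdisc : (discr N₀).natAbs ≤ (discr K).natAbs ^ Module.finrank ℚ N₀ :=
    natAbs_discr_le_pow_of_separating_of_algebra K N₀
      fun s hs => exists_not_mem_fixingSubgroup_fieldRange ℚ K L hs
  have hdN : 3 ≤ (discr N₀).natAbs := three_le_natAbs_discr N₀ hN1
  have hσN : 1 - 1 / (4 * Real.log ((discr N₀).natAbs : ℝ)) ≤ σ :=
    one_sub_inv_log_le (by omega) (by omega) hdisc hm hσ
  have hbox : (σ : ℂ) ∈ starkBox ((discr N₀).natAbs : ℝ) :=
    ofReal_mem_starkBox (by exact_mod_cast (show 1 ≤ (discr N₀).natAbs by omega)) hσN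
  -- `ord_σ ζ_{N₀} ≤ 1` (Stark's Lemma 3), as `n(G, r_G) ≤ 1`
  have e3 : quotientFixedField q (⊥ : Subgroup (N₀ ≃ₐ[ℚ] N₀)) ≃+* N₀ :=
    (IntermediateField.equivOfEq hbot).toRingEquiv
  have hle :
      artinOrder (σ : ℂ) ((Representation.leftRegular ℂ (N₀ ≃ₐ[ℚ] N₀)).character ∘ q) ≤ 1 := by
    have h1 := artinOrder_leftRegular hqA (σ : ℂ)
    rw [meromorphicOrderAt_dedekindZetaCont_eq_of_ringEquiv e3 hs1] at h1
    have h3 := meromorphicOrderAt_dedekindZetaCont_le_one N₀ hN1 hs1 hbox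
    rw [← h1] at h3
    exact_mod_cast h3
  -- `ζ_ℚ(σ) = ζ(σ) < 0`
  have e2 : quotientFixedField q (⊤ : Subgroup (N₀ ≃ₐ[ℚ] N₀)) ≃+* ℚ :=
    ((IntermediateField.equivOfEq htop').trans (IntermediateField.botEquiv ℚ L)).toRingEquiv
  have htop : dedekindZetaCont (quotientFixedField q (⊤ : Subgroup (N₀ ≃ₐ[ℚ] N₀))) σ ≠ 0 := by
    rw [dedekindZetaCont_eq_of_ringEquiv e2 hs1, dedekindZetaCont_rat_eq_riemannZeta_holds hs1]
    exact (riemannZeta_neg_of_pos_of_lt_one hσ0 hσ1).ne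
  -- `ζ_{F_H}(σ) = ζ_K(σ) = 0`
  have e1 : quotientFixedField q H ≃+* K :=
    ((IntermediateField.equivOfEq hHE).trans eK.symm).toRingEquiv
  have hH0 : dedekindZetaCont (quotientFixedField q H) σ = 0 := by
    rw [dedekindZetaCont_eq_of_ringEquiv e1 hs1]
    exact h0
  -- Heilbronn's character is a quadratic character `χ₁ ≠ 1`; `ζ` vanishes at the fixed field of `ker χ₁`
  rcases heilbronnChar_eq_zero_or_eq_coe hqA hs1 hreal hle with hθ | ⟨χ₁, hθ, hpm⟩
  · exact absurd hH0 (dedekindZetaCont_quotientFixedField_ne_zero_of_eq_zero hqA hs1 hθ H)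
  · have hHle : H ≤ χ₁.ker := (dedekindZetaCont_quotientFixedField_eq_zero_iff hqA hs1 hθ H).mp hH0
    have hne : χ₁ ≠ 1 := by
      intro h1
      apply htop
      rw [dedekindZetaCont_quotientFixedField_eq_zero_iff hqA hs1 hθ ⊤, h1, MonoidHom.ker_one]
    have hidx : χ₁.ker.index = 2 := index_ker_eq_two_of_sign hpm hne
    have hk0 : dedekindZetaCont (quotientFixedField q χ₁.ker) σ = 0 :=
      (dedekindZetaCont_quotientFixedField_eq_zero_iff hqA hs1 hθ χ₁.ker).mpr le_rfl
    have h2' : Module.finrank ℚ (quotientFixedField q χ₁.ker) = 2 :=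
      (finrank_quotientFixedField hqA χ₁.ker).trans hidx
    have hle2 : quotientFixedField q χ₁.ker ≤ f.fieldRange :=
      (quotientFixedField_antitone (q := q) hHle).trans_eq hHE
    -- transport the quadratic field back to `K` along `f`
    set E : IntermediateField ℚ L := quotientFixedField q χ₁.ker with hEdef
    have hmap : (E.comap f).map f = E := by
      apply le_antisymm ((IntermediateField.gc_map_comap f).l_u_le E)
      intro x hx
      obtain ⟨y, rfl⟩ := hle2 hx
      exact ⟨y, hx, rfl⟩
    have e4 : (E.comap f) ≃ₐ[ℚ] E :=
      ((E.comap f).equivMap f).trans (IntermediateField.equivOfEq hmap)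
    refine ⟨E.comap f, ?_, ?_⟩
    · have h := e4.toLinearEquiv.finrank_eq
      rw [h]
      convert h2' using 2
    · rw [dedekindZetaCont_eq_of_algEquiv e4 hs1]
      convert hk0 using 2

/-- **Contrapositive form**: for a number field `K` of degree `n > 1` and
`1 − 1/(4·n!·log|d_K|) ≤ σ < 1`, if `ζ_k(σ) ≠ 0` for every quadratic subfield `k ⊆ K`, then
`ζ_K(σ) ≠ 0`. (For `K` without quadratic subfield this is
`Stark1974_dedekindZeta_ne_zero_of_noQuadraticSubfield_holds`.) [cite: Stark1974, Thm. 3]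
[cite: Murty1999StarkZeros, p. 512 (4)] -/
theorem dedekindZetaCont_ne_zero_of_forall_quadratic (K : Type) [Field K] [NumberField K]
    (hK : 1 < Module.finrank ℚ K) {σ : ℝ}
    (hσ : 1 - 1 / (4 * ((Module.finrank ℚ K).factorial : ℝ) * Real.log ((discr K).natAbs : ℝ)) ≤ σ)
    (hσ1 : σ < 1)
    (hk : ∀ k : IntermediateField ℚ K, Module.finrank ℚ k = 2 → dedekindZetaCont k σ ≠ 0) :
    dedekindZetaCont K σ ≠ 0 := by
  intro h0
  obtain ⟨k, hk2, hk0⟩ := exists_quadratic_dedekindZetaCont_eq_zero K hK hσ hσ1 h0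
  exact hk k hk2 hk0

end Literature.NumberTheory.LFunctions.NumberField

end
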